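import Mathlib
import Summits.ValiantsHypothesis.ValiantsHypothesis.Theorems.BarrierLeverPartitionMinorsHitByVPHiddenStatesSplitRule

/-!
# Route BarrierLever — item `PartitionMinorsHitByVP` (stmt-ValiantsHypothesis-19717):
# two-layer hidden families are GOOD for every row family containing a copy of their core (the filling argument)

Helper file (`--supports stmt-ValiantsHypothesis-19717`; cell valiant-natproofs, rung V4, 𝒟-side door (c), line
`hidden-states`; prover seat val-np-p3 gen 9). Definition-free apart from the bookkeeping `curveVec`. Closes NO item.
The POSITIVE counterpart of `…HiddenStatesTripleRank` / `…TwoSkeleton` (memo HOME/val-np-p3/g9 §9, "core reduction"):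

THEOREM (`symbGood_of_core_copy`). Let `e : Fin r → Finset (Fin K)` be two-layer — every member has at most two states and
every two-state member lies inside a set `S` of states — and let `y : Fin K → Fin h` be injective on `S`. If the injective row
family `u` contains the relabelled copy `(e k).image y` of EVERY core member (`e k ⊆ S`), then `SymbGood u e`.
PROOF = the filling argument: with the table `t₀ = 0`, `t_p = e_{y p}` (`p ∈ S`) the core columns form a zeta matrix
`[e k' ⊆ e k]` on the copy rows (block-triangular with identity blocks, determinant `1`), hence are independent; each FREE
state `q ∉ S` (a singleton member) gets the table `t_q(a) = s_q^{2^a}`, whose column `(s_q^{Σ_{a∈u i} 2^a})_i` leaves any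
proper subspace for a suitable `s_q ∈ ℂ` (a nonzero polynomial with distinct exponents has a non-root), so the free columns
complete the core columns to a basis.

USE. For the ball–colex family `𝔅(K, r)` in its two-layer regime (core = `B₁(K') ∪ {first c pairs}`), every row family
whose range contains `∅`, `K'` singletons and the `c` corresponding pairs of SOME `K'` of its vertices — e.g. every family
containing all subsets of size `≤ 2` of a `K'(c)`-set of vertices — is good: the two-layer regime of Conjecture Q\* holds
for all «2-neighbourly enough» complexes, complementing the 2-skeleton obstruction (too many small rows for the core ⇒ BAD).

WHAT THIS IS NOT: no claim for families without a core copy (flat complexes — where the stars and skeleta live); nothing on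
three layers, joins, the door of record, crux 14610 or VP ≠ VNP.
-/

set_option linter.dupNamespace false

namespace Summit.ValiantsHypothesis.ValiantsHypothesis.Theorems.BarrierLever.HiddenStates

open Finset Matrix

noncomputable section

namespace TwoLayer

variable {h : ℕ} {n : Type*}

/-! ## 1. The monomial curve leaves every proper subspace -/

/-- The binary exponent of a set of coordinates: `Σ_{a ∈ U} 2^a` (injective in `U`). -/
theorem binExp_injective : Function.Injective fun U : Finset (Fin h) => ∑ a ∈ U, 2 ^ (a : ℕ) := by
  intro U U' hUU'
  have hm : ∑ k ∈ U.map Fin.valEmbedding, 2 ^ k = ∑ k ∈ U'.map Fin.valEmbedding, 2 ^ k := by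
    simpa [Finset.sum_map] using hUU'
  exact Finset.map_injective Fin.valEmbedding (Finset.geomSum_injective (le_refl 2) hm)

/-- The curve vector of parameter `s` on the rows `u`: `i ↦ s^{Σ_{a ∈ u i} 2^a}` (= `∏_{a ∈ u i} s^{2^a}`). -/
def curveVec (u : n → Finset (Fin h)) (s : ℂ) : n → ℂ := fun i => s ^ (∑ a ∈ u i, 2 ^ (a : ℕ))

/-- The curve vector as the additive-matrix entry of the table `a ↦ s^{2^a}` with zero constant part. -/
theorem curveVec_eq_prod (u : n → Finset (Fin h)) (s : ℂ) (i : n) :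
    curveVec u s i = ∏ a ∈ u i, (0 + s ^ (2 ^ (a : ℕ))) := by
  simp [curveVec, Finset.prod_pow_eq_pow_sum]

/-- **A nonzero combination of distinct powers is a nonzero polynomial**, so it has a non-root: if `u` is injective and
`c ≠ 0` then `Σ_i c_i s^{e(u i)} ≠ 0` for some `s`. -/
theorem exists_curve_not_orthogonal [Fintype n] (u : n → Finset (Fin h)) (hu : Function.Injective u)
    (c : n → ℂ) (hc : c ≠ 0) : ∃ s : ℂ, ∑ i, c i * curveVec u s i ≠ 0 := by
  classical
  -- the polynomial P = Σ_i c_i X^{e_i}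
  set ex : n → ℕ := fun i => ∑ a ∈ u i, 2 ^ (a : ℕ) with hex
  have hex_inj : Function.Injective ex := fun i j hij => hu (binExp_injective hij)
  set P : Polynomial ℂ := ∑ i, Polynomial.C (c i) * Polynomial.X ^ ex i with hP
  have hPeval : ∀ s, P.eval s = ∑ i, c i * curveVec u s i := by
    intro s
    simp [hP, Polynomial.eval_finsetSum, curveVec, hex]
  have hPne : P ≠ 0 := by
    obtain ⟨i₀, hi₀⟩ := Function.ne_iff.mp hc
    intro hzero
    have hcoeff : P.coeff (ex i₀) = c i₀ := by
      rw [hP, Polynomial.finsetSum_coeff]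
      simp only [Polynomial.coeff_C_mul, Polynomial.coeff_X_pow]
      rw [Finset.sum_eq_single i₀]
      · simp
      · intro j _ hj
        rw [if_neg (fun h' => hj (hex_inj h'.symm))]
        ring
      · intro h'; exact absurd (Finset.mem_univ i₀) h'
    rw [hzero, Polynomial.coeff_zero] at hcoeff
    exact hi₀ hcoeff.symm
  -- a nonzero polynomial over ℂ has a non-root
  by_contra hall
  push Not at hall
  apply hPne
  apply Polynomial.eq_zero_of_infinite_isRoot
  have : {s : ℂ | P.IsRoot s} = Set.univ := by
    ext s
    simp [Polynomial.IsRoot, hPeval, hall s]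
  rw [this]
  exact Set.infinite_univ

/-- **The curve leaves every proper subspace**: for injective rows and a proper submodule `W` of `n → ℂ`, some curve
vector lies outside `W`. -/
theorem exists_curveVec_not_mem [Fintype n] (u : n → Finset (Fin h)) (hu : Function.Injective u)
    (W : Submodule ℂ (n → ℂ)) (hW : W < ⊤) : ∃ s : ℂ, curveVec u s ∉ W := by
  classical
  obtain ⟨f, hf, hfW⟩ := Submodule.exists_le_ker_of_lt_top W hW
  -- the functional as a coefficient vector
  set c : n → ℂ := fun i => f (Pi.single i 1) with hcdef
  have hfc : ∀ v : n → ℂ, f v = ∑ i, c i * v i := by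
    intro v
    conv_lhs => rw [show v = ∑ i, v i • (Pi.single i 1 : n → ℂ) from by
      ext j; simp [Finset.sum_apply, Pi.single_apply]]
    rw [map_sum]
    simp only [map_smul, smul_eq_mul, hcdef]
    exact Finset.sum_congr rfl fun i _ => mul_comm _ _
  have hc : c ≠ 0 := by
    intro hc0
    apply hf
    apply LinearMap.ext
    intro v
    rw [hfc v]
    simp [hc0]
  obtain ⟨s, hs⟩ := exists_curve_not_orthogonal u hu c hc
  refine ⟨s, fun hmem => hs ?_⟩
  have := hfW hmem
  rw [LinearMap.mem_ker, hfc] at this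
  exact this

/-! ## 2. The zeta argument: columns indexed by distinct sets, evaluated on their own copies, are independent -/

/-- If `α` is supported on a set of columns `A`, each column `k ∈ A` has a "copy row" `ρ k` with
`col k' (ρ k) = [e k ⊆ e k']` for `k, k' ∈ A`, and `e` is injective, then `Σ_k α_k col_k = 0` forces `α = 0` on `A`
(look at a column of maximal cardinality among the support). -/
theorem eq_zero_of_zeta {K : ℕ} [Fintype n] [DecidableEq n] (e : n → Finset (Fin K)) (he : Function.Injective e)
    (col : n → (n → ℂ)) (A : Finset n) (ρ : n → n)
    (hzeta : ∀ k ∈ A, ∀ k' ∈ A, col k' (ρ k) = if e k ⊆ e k' then 1 else 0)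
    (α : n → ℂ) (hαA : ∀ k, k ∉ A → α k = 0) (hsum : ∑ k, α k • col k = 0) : ∀ k, α k = 0 := by
  classical
  by_contra hne
  push Not at hne
  -- a nonzero coefficient of maximal cardinality
  obtain ⟨k₀, hk₀, hmax⟩ := Finset.exists_max_image (Finset.univ.filter fun k => α k ≠ 0) (fun k => (e k).card)
    (by obtain ⟨k, hk⟩ := hne; exact ⟨k, by simpa using hk⟩)
  have hα₀ : α k₀ ≠ 0 := by simpa using hk₀
  have hk₀A : k₀ ∈ A := by by_contra h'; exact hα₀ (hαA k₀ h')
  -- evaluate the relation at the copy row of k₀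
  have hrow := congrFun hsum (ρ k₀)
  rw [Finset.sum_apply, Pi.zero_apply] at hrow
  simp only [Pi.smul_apply, smul_eq_mul] at hrow
  rw [Finset.sum_eq_single k₀] at hrow
  · rw [hzeta k₀ hk₀A k₀ hk₀A, if_pos (subset_refl _), mul_one] at hrow
    exact hα₀ hrow
  · intro k _ hk
    by_cases hkA : k ∈ A
    · rw [hzeta k₀ hk₀A k hkA]
      by_cases hsub : e k₀ ⊆ e k
      · -- then |e k| > |e k₀|, so α k = 0 by maximality
        have hss : e k₀ ⊂ e k := lt_of_le_of_ne hsub (fun h' => hk (he h').symm)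
        have hcard : (e k₀).card < (e k).card := Finset.card_lt_card hss
        have hαk : α k = 0 := by
          by_contra h'
          have := hmax k (by simpa using h')
          omega
        rw [hαk, zero_mul]
      · rw [if_neg hsub, mul_zero]
    · rw [hαA k hkA, zero_mul]
  · intro h'; exact absurd (Finset.mem_univ k₀) h'

/-! ## 3. The table and its columns -/

section table

variable {K : ℕ}
variable (u : n → Finset (Fin h)) (S : Finset (Fin K)) (y : Fin K → Fin h) (τ : Fin K → ℂ)

/-- The witness table: `t₀ = 0`; a core state `p ∈ S` is sent to the basis vector of `y p`; a free state `p ∉ S` to the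
curve point `(τ_p^{2^a})_a`. -/
def wTab : Option (Fin K) → Fin h → ℂ
  | none => fun _ => 0
  | some p => fun a => if p ∈ S then (if y p = a then 1 else 0) else τ p ^ (2 ^ (a : ℕ))

/-- The affine functional of a core member `J ⊆ S` at coordinate `a` is the indicator of `a ∈ J.image y`
(for `y` injective on `S`). -/
theorem lin_wTab_core (hy : Set.InjOn y S) (J : Finset (Fin K)) (hJ : J ⊆ S) (a : Fin h) :
    wTab S y τ none a + ∑ q ∈ J, wTab S y τ (some q) a = if a ∈ J.image y then 1 else 0 := by
  classical
  simp only [wTab, zero_add]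
  have hterm : ∀ q ∈ J, (if q ∈ S then (if y q = a then (1 : ℂ) else 0) else τ q ^ 2 ^ (a : ℕ)) =
      if y q = a then 1 else 0 := fun q hq => by rw [if_pos (hJ hq)]
  rw [Finset.sum_congr rfl hterm]
  by_cases ha : a ∈ J.image y
  · rw [if_pos ha]
    obtain ⟨q₀, hq₀, rfl⟩ := Finset.mem_image.mp ha
    rw [Finset.sum_eq_single q₀]
    · simp
    · intro q hq hqq₀
      rw [if_neg]
      intro h'
      exact hqq₀ (hy (hJ hq) (hJ hq₀) h')
    · intro h'; exact absurd hq₀ h'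
  · rw [if_neg ha]
    refine Finset.sum_eq_zero fun q hq => ?_
    rw [if_neg]
    intro h'
    exact ha (Finset.mem_image.mpr ⟨q, hq, h'⟩)

/-- **Core columns**: for `J = e k ⊆ S`, the entry at row `i` is `[u i ⊆ (e k).image y]`. -/
theorem entry_core (hy : Set.InjOn y S) (i : n) (J : Finset (Fin K)) (hJ : J ⊆ S) :
    ∏ a ∈ u i, (wTab S y τ none a + ∑ q ∈ J, wTab S y τ (some q) a) = if u i ⊆ J.image y then 1 else 0 := by
  classical
  simp_rw [lin_wTab_core S y τ hy J hJ]
  rw [Finset.prod_boole]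
  by_cases hsub : u i ⊆ J.image y
  · rw [if_pos hsub, if_pos (fun a ha => hsub ha)]
  · rw [if_neg hsub, if_neg (fun hall => hsub (fun a ha => hall a ha))]

/-- **Free columns**: for `J = {p}` with `p ∉ S`, the entry at row `i` is the curve vector `curveVec u (τ p) i`. -/
theorem entry_free (i : n) (p : Fin K) (hp : p ∉ S) :
    ∏ a ∈ u i, (wTab S y τ none a + ∑ q ∈ ({p} : Finset (Fin K)), wTab S y τ (some q) a) = curveVec u (τ p) i := by
  simp [wTab, hp, curveVec, Finset.prod_pow_eq_pow_sum]

end table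

/-! ## 4. The main theorem: filling with free states -/

section main

variable {K : ℕ} [Fintype n] [DecidableEq n]

/-- **Two-layer families are good for every row family containing a copy of their core.** -/
theorem symbGood_of_core_copy (u : n → Finset (Fin h)) (hu : Function.Injective u) (e : n → Finset (Fin K))
    (he : Function.Injective e) (S : Finset (Fin K)) (he2 : ∀ k, (e k).card ≤ 2)
    (heS : ∀ k, (e k).card = 2 → e k ⊆ S) (y : Fin K → Fin h) (hy : Set.InjOn y S)
    (hcopy : ∀ k, e k ⊆ S → ∃ i, u i = (e k).image y) : SymbGood u e := by
  classical
  -- copy rows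
  choose! ρ hρ using hcopy
  -- columns as a function of the free parameters
  let col : (Fin K → ℂ) → n → (n → ℂ) := fun τ k i =>
    ∏ a ∈ u i, (wTab S y τ none a + ∑ q ∈ e k, wTab S y τ (some q) a)
  -- independence of the columns supported on a set A, for parameters τ
  let Indep : (Fin K → ℂ) → Finset n → Prop := fun τ A =>
    ∀ α : n → ℂ, (∀ k, k ∉ A → α k = 0) → ∑ k, α k • col τ k = 0 → ∀ k, α k = 0
  let core : Finset n := Finset.univ.filter fun k => e k ⊆ S
  -- core columns do not depend on τ and are independent (zeta argument)
  have hcorecol : ∀ τ, ∀ k ∈ core, ∀ i, col τ k i = if u i ⊆ (e k).image y then 1 else 0 := by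
    intro τ k hk i
    have hk' : e k ⊆ S := by simpa [core] using hk
    exact entry_core u S y τ hy i (e k) hk'
  have hfreecol : ∀ τ k, k ∉ core → ∃ p, e k = {p} ∧ p ∉ S ∧ col τ k = curveVec u (τ p) := by
    intro τ k hk
    have hk' : ¬ e k ⊆ S := by simpa [core] using hk
    have hcard : (e k).card = 1 := by
      have h2 := he2 k
      rcases Nat.lt_or_ge (e k).card 1 with h0 | h1
      · have h0' : (e k).card = 0 := by omega
        have hem : e k = ∅ := Finset.card_eq_zero.mp h0'
        exact absurd (by rw [hem]; exact Finset.empty_subset S) hk'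
      · rcases Nat.lt_or_ge (e k).card 2 with h1' | h2'
        · omega
        · exact absurd (heS k (by omega)) hk'
    obtain ⟨p, hp⟩ := Finset.card_eq_one.mp hcard
    have hpS : p ∉ S := fun h' => hk' (by rw [hp]; exact Finset.singleton_subset_iff.mpr h')
    refine ⟨p, hp, hpS, ?_⟩
    funext i
    show ∏ a ∈ u i, (wTab S y τ none a + ∑ q ∈ e k, wTab S y τ (some q) a) = curveVec u (τ p) i
    rw [hp]
    exact entry_free u S y τ i p hpS
  have hbase : ∀ τ, Indep τ core := by
    intro τ α hαA hsum
    refine eq_zero_of_zeta e he (col τ) core ρ ?_ α hαA hsum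
    intro k hk k' hk'
    have hk₁ : e k ⊆ S := by simpa [core] using hk
    have hk'₁ : e k' ⊆ S := by simpa [core] using hk'
    rw [hcorecol τ k' hk' (ρ k), hρ k hk₁]
    -- [image y (e k) ⊆ image y (e k')] = [e k ⊆ e k'] by injectivity of y on S
    by_cases hsub : e k ⊆ e k'
    · rw [if_pos hsub, if_pos (Finset.image_subset_image hsub)]
    · rw [if_neg hsub, if_neg]
      intro himg
      apply hsub
      intro q hq
      have : y q ∈ (e k').image y := himg (Finset.mem_image_of_mem y hq)
      obtain ⟨q', hq', hyq⟩ := Finset.mem_image.mp this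
      have : q' = q := hy (hk'₁ hq') (hk₁ hq) hyq
      rw [← this]; exact hq'
  -- induction: add the free columns one at a time
  have hstep : ∀ (T : Finset n), core ⊆ T → (∃ τ, Indep τ T) → ∀ k₁, k₁ ∉ T → ∃ τ, Indep τ (insert k₁ T) := by
    intro T hcT ⟨τ, hτ⟩ k₁ hk₁
    have hk₁core : k₁ ∉ core := fun h' => hk₁ (hcT h')
    obtain ⟨p₁, hp₁, hp₁S, -⟩ := hfreecol τ k₁ hk₁core
    -- the span of the current columns is a proper subspace
    set W : Submodule ℂ (n → ℂ) := Submodule.span ℂ (Set.range fun k : T => col τ k) with hW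
    have hWlt : W < ⊤ := by
      have h1 : Module.finrank ℂ W ≤ Fintype.card T := finrank_range_le_card _
      have h2 : Fintype.card T < Fintype.card n := by
        rw [Fintype.card_coe]
        exact Finset.card_lt_card (Finset.ssubset_iff_subset_ne.mpr ⟨Finset.subset_univ T,
          fun h' => hk₁ (h' ▸ Finset.mem_univ k₁)⟩)
      have h3 : Module.finrank ℂ (n → ℂ) = Fintype.card n := Module.finrank_fintype_fun_eq_card ℂ
      exact Submodule.lt_top_of_finrank_lt_finrank (by omega)
    obtain ⟨s, hs⟩ := exists_curveVec_not_mem u hu W hWlt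
    -- new parameters: τ updated at p₁
    let τ' : Fin K → ℂ := Function.update τ p₁ s
    have hsame : ∀ k ∈ T, col τ' k = col τ k := by
      intro k hk
      by_cases hkc : k ∈ core
      · funext i; rw [hcorecol τ' k hkc i, hcorecol τ k hkc i]
      · obtain ⟨p, hp, hpS, hcol'⟩ := hfreecol τ' k hkc
        obtain ⟨p', hp', -, hcol⟩ := hfreecol τ k hkc
        have hpp' : p = p' := by
          have := hp.symm.trans hp'
          exact Finset.singleton_injective this
        have hpne : p ≠ p₁ := by
          intro h'
          apply hk₁
          have : e k = e k₁ := by rw [hp, h', hp₁]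
          rwa [← he this]
        rw [hcol', hcol, ← hpp']
        simp [τ', Function.update_of_ne hpne]
    have hnew : col τ' k₁ = curveVec u s := by
      obtain ⟨p, hp, -, hcol'⟩ := hfreecol τ' k₁ hk₁core
      have : p = p₁ := Finset.singleton_injective (hp.symm.trans hp₁)
      rw [hcol', this]
      simp [τ']
    refine ⟨τ', fun α hαA hsum => ?_⟩
    -- if α k₁ ≠ 0, the new column would lie in W
    have hαk₁ : α k₁ = 0 := by
      by_contra hne
      apply hs
      have hexpr : curveVec u s = -(α k₁)⁻¹ • ∑ k ∈ T, α k • col τ k := by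
        have hsplit : ∑ k, α k • col τ' k = α k₁ • col τ' k₁ + ∑ k ∈ T, α k • col τ' k := by
          rw [← Finset.sum_subset (Finset.subset_univ (insert k₁ T))
            (fun k _ hk => by rw [hαA k hk, zero_smul]), Finset.sum_insert hk₁]
        rw [hsplit, hnew] at hsum
        have hT : ∑ k ∈ T, α k • col τ' k = ∑ k ∈ T, α k • col τ k :=
          Finset.sum_congr rfl fun k hk => by rw [hsame k hk]
        rw [hT] at hsum
        have : α k₁ • curveVec u s = -∑ k ∈ T, α k • col τ k := eq_neg_of_add_eq_zero_left hsum
        calc curveVec u s = (α k₁)⁻¹ • (α k₁ • curveVec u s) := by rw [smul_smul, inv_mul_cancel₀ hne, one_smul]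
          _ = -(α k₁)⁻¹ • ∑ k ∈ T, α k • col τ k := by rw [this, smul_neg, neg_smul]
      rw [hexpr]
      refine Submodule.smul_mem _ _ (Submodule.sum_mem _ fun k hk => Submodule.smul_mem _ _ ?_)
      exact Submodule.subset_span ⟨⟨k, hk⟩, rfl⟩
    -- then α is supported on T and the old independence applies
    have hαT : ∀ k, k ∉ T → α k = 0 := by
      intro k hk
      by_cases hkk : k = k₁
      · rw [hkk]; exact hαk₁
      · exact hαA k (fun h' => by rcases Finset.mem_insert.mp h' with h'' | h''; exact hkk h''; exact hk h'')
    have hsum' : ∑ k, α k • col τ k = 0 := by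
      rw [← hsum]
      refine Finset.sum_congr rfl fun k _ => ?_
      by_cases hkT : k ∈ T
      · rw [hsame k hkT]
      · rw [hαT k hkT, zero_smul, zero_smul]
    exact hτ α hαT hsum'
  -- conclude: all columns independent for some τ (induction over the added free columns)
  have hall : ∃ τ, Indep τ Finset.univ := by
    have H : ∀ D : Finset n, ∃ τ, Indep τ (core ∪ D) := by
      intro D
      induction D using Finset.induction_on with
      | empty => exact ⟨fun _ => 0, by rw [Finset.union_empty]; exact hbase _⟩
      | @insert k D hkD ih =>
        by_cases hk : k ∈ core ∪ D
        · have : core ∪ insert k D = core ∪ D := by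
            rw [Finset.union_insert, Finset.insert_eq_of_mem hk]
          rw [this]; exact ih
        · have := hstep (core ∪ D) Finset.subset_union_left ih k hk
          rwa [← Finset.union_insert] at this
    have := H Finset.univ
    have hu' : core ∪ Finset.univ = Finset.univ := by ext; simp
    rwa [hu'] at this
  obtain ⟨τ, hτ⟩ := hall
  -- det ≠ 0 for the table wTab S y τ
  refine symbGood_of_table u e (wTab S y τ) ?_
  intro hdet
  obtain ⟨α, hαne, hαmul⟩ := Matrix.exists_mulVec_eq_zero_iff.mpr hdet
  apply hαne
  funext k
  refine hτ α (fun k hk => absurd (Finset.mem_univ k) hk) ?_ k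
  funext i
  have := congrFun hαmul i
  rw [Matrix.mulVec, dotProduct] at this
  simp only [Matrix.of_apply, Pi.zero_apply] at this
  rw [Finset.sum_apply, Pi.zero_apply]
  simpa [Pi.smul_apply, smul_eq_mul, mul_comm] using this

end main

end TwoLayer

end

end Summit.ValiantsHypothesis.ValiantsHypothesis.Theorems.BarrierLever.HiddenStates
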